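import Literature.Claims.NS.Siche2026
import HarnessLib

/-!
# Solo salvage for claim C135 `Siche2026` (cell `ns-claims`, D-0090): Step 8 (§8 «Proof of Theorem 1.2»,
# pp. 25–27) on the Clay data class is TRUE — the a priori enstrophy bound makes EVERY Leray–Hopf solution
# from a smooth divergence-free datum smooth for `t > 0` and unique, kernel

Claim skeleton: `Literature/Claims/NS/Siche2026.lean` (B. Siche, Zenodo 10.5281/zenodo.19899171 v1.5;
typist `ns-claims-typist-3` g4, p500157 + rev 2 p500644 + rev 3 p505052). ADJUDICATED #118 (lead g4
2026-08-27T07:23:33Z): first failing step `Step4_globalDecoherence` = Thm 6.28 (51) p. 22, false lemma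
(`…Theorems.Siche2026.not_Step4_globalDecoherence` p508594). The skeleton's last step
`Step8_regularity := AprioriEnstrophy → ClaimedTheorem` (§8: BKM continuation, parabolic bootstrap, Galerkin
Prop. 8.1 p. 26, weak–strong uniqueness [36, Thm III.3.7] p. 26 Step 4) is typed for `H¹` data and left
unproved there. This file (seat `ns-claims-salvage-p3` g4) certifies its CLAY-CLASS INSTANCE: for a SMOOTH
divergence-free datum on `𝕋³`, the a priori enstrophy bound along classical solutions (`AprioriEnstrophy`)
yields (i) a global classical solution `(v, p)` on `[0, ∞)` from the datum (the skeleton's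
`clayAt_of_apriori` read on the torus by `ClayVariants.clayPeriodic_regularityAt_iff_torus` —
Robinson–Rodrigo–Sadowski 2016 §6.3/§8.1 maximal solution with the enstrophy alternative), (ii) EVERY global
Leray–Hopf weak solution from the datum agrees with `v` a.e. on every slice `t > 0` (Sather–Serrin
weak–strong uniqueness, tree `Torus.IsGlobalLerayHopf.ae_eq_of_isClassicalNSSolutionOn_Ici`, RRS 2016
Thm. 6.10), hence (iii) any two Leray–Hopf solutions from the datum agree a.e. for `t > 0`. The typed
`H¹` grain of Step 8 needs in addition the `𝕋³` local strong theory from `V`-data with instantaneous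
smoothing and weak–strong uniqueness against a `V`-strong reference (Kiselev–Ladyzhenskaya 1957; RRS 2016
Thm. 6.8, §7, Thm. 6.10 in printed generality), which the tree does not hold today — recorded in
`claims/Siche2026/SALVAGE.md`, not attempted here.

* `claimedTheorem_smoothData_of_apriori` — `AprioriEnstrophy` ⇒ Theorem 1.2's conclusion for smooth data;
* `claimedTheorem_smoothData_of_steps` — the same from Steps 4–7 (so on the Clay class Step 8 adds nothing
  to the chain `apriori_of_steps`).

Solo lane (`Theorems/SoloSalvage<Slug>….lean`, no item).

WHAT THIS IS NOT: not a claim about NS regularity or blow-up; not a claim about any author beyond the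
typed locator.
-/

noncomputable section

set_option linter.dupNamespace false

open Set MeasureTheory

namespace Summit.NavierStokesRegularity.NavierStokesRegularity.Theorems.Siche2026Salvage

open Literature.Analysis Literature.Analysis.FluidPDE Literature.Analysis.FunctionSpaces
open Literature.Claims.NS Literature.Claims.NS.Siche2026 Literature.Claims.NS.ClayVariants

/-- **Step 8 on the Clay data class** (§8 «Proof of Theorem 1.2», Steps 3–5 pp. 25–26: «sup_{t>0} Ω(t) < ∞
… Therefore no blowup occurs», «bootstraps to u ∈ C^∞(T³ × (0,∞))», «Uniqueness across all Leray–Hopf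
solutions … weak–strong uniqueness theorem [36, Theorem III.3.7]»): if every classical solution of the
unforced system on each `[0, T) × 𝕋³` has bounded enstrophy (`AprioriEnstrophy`), then for every `ν > 0`,
every SMOOTH divergence-free datum `u₀` on `𝕋³` and every global Leray–Hopf weak solution `u` from `u₀`
there is a classical solution `(v, p)` on `(0, ∞) × 𝕋³` with `u(t) = v(t)` a.e. for all `t > 0`, and any
two global Leray–Hopf solutions from `u₀` agree a.e. on every slice `t > 0`. Proof: the a priori bound is
Clay (B) at `ν` (`clayAt_of_apriori`), i.e. a global classical `(v, p)` on `[0, ∞)` with `v 0 = u₀`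
(`clayPeriodic_regularityAt_iff_torus`); weak–strong uniqueness identifies every Leray–Hopf solution from
`u₀ = v 0` with `v` a.e. on `t > 0`. [cite: Siche2026, §8 Proof of Theorem 1.2, Steps 3–5 pp. 25–26]
[cite: RobinsonRodrigoSadowskiCUP2016, Thm 6.10; §6.3; §8.1] -/
theorem claimedTheorem_smoothData_of_apriori (h : AprioriEnstrophy) :
    ∀ ν : ℝ, 0 < ν → ∀ u₀ : T3 → E3, Torus.IsSmooth u₀ → Torus.IsDivFree u₀ →
      ∀ u : ℝ → T3 → E3, Torus.IsGlobalLerayHopf ν 0 u₀ u →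
        (∃ (v : ℝ → T3 → E3) (p : ℝ → T3 → ℝ),
            Torus.IsClassicalNSSolutionOn (Ioi 0) ν 0 v p ∧ ∀ t : ℝ, 0 < t → u t =ᵐ[volume] v t) ∧
          ∀ u' : ℝ → T3 → E3, Torus.IsGlobalLerayHopf ν 0 u₀ u' →
            ∀ t : ℝ, 0 < t → u' t =ᵐ[volume] u t := by
  intro ν hν u₀ hs hd u hu
  have hreg := clayAt_of_apriori h hν
  rw [clayPeriodic_regularityAt_iff_torus hν] at hreg
  obtain ⟨v, p, hglob, hv0⟩ := hreg u₀ hs hd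
  -- every global Leray–Hopf solution from `u₀ = v 0` agrees with `v` a.e. on `t > 0`
  have hae : ∀ w : ℝ → T3 → E3, Torus.IsGlobalLerayHopf ν 0 u₀ w →
      ∀ t : ℝ, 0 < t → w t =ᵐ[volume] v t := by
    intro w hw
    have hw' : Torus.IsGlobalLerayHopf ν 0 (v 0) w := by rw [hv0]; exact hw
    exact hw'.ae_eq_of_isClassicalNSSolutionOn_Ici hglob hν.le
  refine ⟨⟨v, p, hglob.mono Ioi_subset_Ici_self (uniqueDiffOn_Ioi 0), hae u hu⟩, ?_⟩
  intro u' hu' t ht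
  exact (hae u' hu' t ht).trans (hae u hu t ht).symm

/-- **On the Clay class Step 8 adds nothing to the chain**: Steps 4–7 (`apriori_of_steps`) already give
Theorem 1.2's conclusion for smooth data — every global Leray–Hopf solution from a smooth divergence-free
datum is a.e. a classical solution on `(0, ∞)`, and Leray–Hopf solutions from the datum are unique.
(Steps 4, 5, 6 are kernel-false — `not_Step4_globalDecoherence`, `not_Step5_shiftedCoherence`,
`not_Step6_vorticityBound`; this records only that the composition through §8 is sound on the Clay class.)
[cite: Siche2026, §8 pp. 25–27; §1.5 (3) p. 3] -/
theorem claimedTheorem_smoothData_of_steps (h4 : Step4_globalDecoherence) (h5 : Step5_shiftedCoherence)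
    (h6 : Step6_vorticityBound) (h7 : Step7_enstrophyClosure) :
    ∀ ν : ℝ, 0 < ν → ∀ u₀ : T3 → E3, Torus.IsSmooth u₀ → Torus.IsDivFree u₀ →
      ∀ u : ℝ → T3 → E3, Torus.IsGlobalLerayHopf ν 0 u₀ u →
        (∃ (v : ℝ → T3 → E3) (p : ℝ → T3 → ℝ),
            Torus.IsClassicalNSSolutionOn (Ioi 0) ν 0 v p ∧ ∀ t : ℝ, 0 < t → u t =ᵐ[volume] v t) ∧
          ∀ u' : ℝ → T3 → E3, Torus.IsGlobalLerayHopf ν 0 u₀ u' →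
            ∀ t : ℝ, 0 < t → u' t =ᵐ[volume] u t :=
  claimedTheorem_smoothData_of_apriori (apriori_of_steps h4 h5 h6 h7)

end Summit.NavierStokesRegularity.NavierStokesRegularity.Theorems.Siche2026Salvage

end
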